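import Mathlib.Order.SupClosed
import Mathlib.Data.Setoid.Basic
import Literature.Analysis.FluidPDE.HardSphereRegularGeometry
import HarnessLib

/-!
# The energy-cluster partition of a hard-sphere configuration on the torus

Brick `stub_eqMomentEnergyPartition` (registered sub-goal) toward the stub `stub_eqMoment` of the line
`Sketch` of the crux `ContactAngleEquidistribution` (stmt-AtomisticToContinuum-12097, route
LambertianContactSwap), the STATIC input of `…EqMomentClusterAutonomy`: that theorem makes the blocks of
ANY labelling of the particles autonomous during a window `[a, a + h]` provided, at the window start,
particles of different blocks are at minimal-image distance `> ε + h (√(2E_α) + √(2E_β))`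
(`E_α` = kinetic energy of a block).  Here we construct the canonical such labelling of a configuration
`w` — its **energy-cluster partition** `energyPartition ε h w`, the FINEST energy-separated equivalence
relation on the labels — and prove what the cluster route consumes:

* `energyPartition_separated` — it is energy-separated (energy-separated relations are closed under
  intersection, `inf_separated`, because sub-block energies are smaller; and finite in number);
* `energyPartition_le` — it is finer than every energy-separated relation;
* `exists_close_pair_of_cut` — its blocks cannot be split: any proper cut `U` of a block has a pair
  `u ∈ U`, `v ∉ U` of the block at distance `≤ ε + h (√(2E_{U-part}) + √(2E_{rest}))` (otherwise cutting
  `U` out would give a strictly finer energy-separated relation) — so a block `B` is connected at scale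
  `ε + 2h √(2E_B)`, the input of the static cluster-size tail estimates under the Gibbs law;
* `stub_eqMomentEnergyPartition` — the separation restated for the labelling `cl = Quotient.mk _`
  in the exact form of the hypothesis `hsep` of `stub_eqMomentClusterAutonomy`.

Design: equivalence relations as Mathlib's complete lattice `Setoid (Fin N)`; the partition is an
`sInf`; `blockEnergy₂ w s i = Σ_{k ~ i} ‖v_k‖²` is twice the block kinetic energy.  This is the static
half of the classical cluster decompositions of hard-sphere dynamics (Alexander 1975), made canonical
(no choices) so that it is a deterministic functional of the window-start configuration.

References: R. K. Alexander, *The infinite hard sphere system*, Ph.D. thesis, Berkeley (1975)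
[Alexander1975]; I. Gallagher, L. Saint-Raymond, B. Texier, *From Newton to Boltzmann*, EMS (2013),
§4.1 [GST2013].
-/

noncomputable section

open Set Function
open scoped BigOperators Classical

namespace Summit.AtomisticToContinuum.HydrodynamicLimit.Theorems.ContactAngleEquidistributionSketch

open Literature.Analysis.FluidPDE

variable {d : Type*} [Fintype d] {N : ℕ}

/-! ## Block kinetic energies of an equivalence relation on the labels -/

/-- Twice the kinetic energy of the block of `i` under the equivalence relation `s` on the labels:
`Σ_{k ~ i} ‖v_k‖²`. [folklore] -/
def blockEnergy₂ {X : Type*} (w : Config N d X) (s : Setoid (Fin N)) (i : Fin N) : ℝ :=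
  ∑ k, if s k i then ‖(w k).2‖ ^ 2 else 0

/-- Block energies are monotone in the relation: a finer relation has smaller blocks. [folklore] -/
theorem blockEnergy₂_mono {X : Type*} (w : Config N d X) {s s' : Setoid (Fin N)} (h : s ≤ s')
    (i : Fin N) : blockEnergy₂ w s i ≤ blockEnergy₂ w s' i := by
  unfold blockEnergy₂
  refine Finset.sum_le_sum fun k _ => ?_
  by_cases hk : s k i
  · rw [if_pos hk, if_pos (h hk)]
  · rw [if_neg hk]; split_ifs <;> positivity

/-- Equivalent particles have the same block energy. [folklore] -/
theorem blockEnergy₂_eq_of_rel {X : Type*} (w : Config N d X) (s : Setoid (Fin N)) {i j : Fin N}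
    (h : s i j) : blockEnergy₂ w s i = blockEnergy₂ w s j := by
  unfold blockEnergy₂
  refine Finset.sum_congr rfl fun k _ => ?_
  rw [show s k i ↔ s k j from ⟨fun hk => s.trans' hk h, fun hk => s.trans' hk (s.symm' h)⟩]

/-- The block energy is a measurable function of the configuration (torus). [folklore] -/
theorem measurable_blockEnergy₂ (s : Setoid (Fin N)) (i : Fin N) :
    Measurable fun w : Config N d (UnitAddTorus d) => blockEnergy₂ w s i := by
  unfold blockEnergy₂
  refine Finset.measurable_sum _ fun k _ => ?_
  by_cases hk : s k i
  · simp only [hk, if_true]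
    exact ((measurable_pi_apply k).snd.norm).pow_const 2
  · simp only [hk, if_false]; exact measurable_const

/-- With the labelling `cl = Quotient.mk s`, the block energy of `stub_eqMomentClusterAutonomy` is
`blockEnergy₂`. [folklore] -/
theorem sum_ite_quotient_eq_blockEnergy₂ {X : Type*} (w : Config N d X) (s : Setoid (Fin N))
    (i : Fin N) : (∑ k, if (Quotient.mk s k : Quotient s) = Quotient.mk s i then ‖(w k).2‖ ^ 2 else 0) =
      blockEnergy₂ w s i := by
  unfold blockEnergy₂
  refine Finset.sum_congr rfl fun k _ => ?_
  simp only [Quotient.eq]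

/-! ## The energy-cluster partition -/

/-- **The energy-cluster partition** of the configuration `w` at diameter `ε` and window length `h`:
the FINEST equivalence relation `s` on the labels that is ENERGY-SEPARATED — any two inequivalent
particles are at minimal-image distance `> ε + h (√(blockEnergy₂ w s i) + √(blockEnergy₂ w s j))` —
namely the infimum of all of them (it is itself energy-separated, `energyPartition_separated`).  The
canonical static cluster decomposition of cluster dynamics (Alexander 1975). [folklore] -/
def energyPartition (ε h : ℝ) (w : Config N d (UnitAddTorus d)) : Setoid (Fin N) :=
  sInf {s | ∀ i j, ¬ s i j → ε + h * (Real.sqrt (blockEnergy₂ w s i) + Real.sqrt (blockEnergy₂ w s j)) <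
    Torus.euclidDist (w i).1 (w j).1}

section Partition

variable {ε h : ℝ} {w : Config N d (UnitAddTorus d)}

/-- Energy separation passes to a finer relation along monotonicity of the block energies (`h ≥ 0`):
if `s' ≤ s` and the pair `(i, j)` is energy-separated for `s`, it is for `s'`. [folklore] -/
theorem separated_of_le (hh : 0 ≤ h) {s s' : Setoid (Fin N)} (hle : s' ≤ s) {i j : Fin N}
    (hs : ε + h * (Real.sqrt (blockEnergy₂ w s i) + Real.sqrt (blockEnergy₂ w s j)) <
      Torus.euclidDist (w i).1 (w j).1) :
    ε + h * (Real.sqrt (blockEnergy₂ w s' i) + Real.sqrt (blockEnergy₂ w s' j)) <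
      Torus.euclidDist (w i).1 (w j).1 := by
  have hmi := Real.sqrt_le_sqrt (blockEnergy₂_mono w hle i)
  have hmj := Real.sqrt_le_sqrt (blockEnergy₂_mono w hle j)
  nlinarith [mul_le_mul_of_nonneg_left (add_le_add hmi hmj) hh]

/-- Energy-separated relations are closed under intersection (`h ≥ 0`). [folklore] -/
theorem inf_separated (hh : 0 ≤ h) {s s' : Setoid (Fin N)}
    (hs : ∀ i j, ¬ s i j → ε + h * (Real.sqrt (blockEnergy₂ w s i) + Real.sqrt (blockEnergy₂ w s j)) <
      Torus.euclidDist (w i).1 (w j).1)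
    (hs' : ∀ i j, ¬ s' i j → ε + h * (Real.sqrt (blockEnergy₂ w s' i) + Real.sqrt (blockEnergy₂ w s' j)) <
      Torus.euclidDist (w i).1 (w j).1) :
    ∀ i j, ¬ (s ⊓ s') i j → ε + h * (Real.sqrt (blockEnergy₂ w (s ⊓ s') i) +
      Real.sqrt (blockEnergy₂ w (s ⊓ s') j)) < Torus.euclidDist (w i).1 (w j).1 := by
  intro i j hij'
  have hij : ¬ s i j ∨ ¬ s' i j := not_and_or.1 fun h => hij' (Setoid.inf_iff_and.2 h)
  rcases hij with hij | hij
  · exact separated_of_le hh inf_le_left (hs i j hij)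
  · exact separated_of_le hh inf_le_right (hs' i j hij)

/-- There are finitely many equivalence relations on `Fin N` (a theorem, not an instance: used
locally with `haveI`). [folklore] -/
theorem finite_setoid_fin : Finite (Setoid (Fin N)) :=
  Finite.of_injective (fun s : Setoid (Fin N) => (⇑s : Fin N → Fin N → Prop))
    fun s₁ s₂ hst => Setoid.ext fun x y => iff_of_eq (congrFun (congrFun (show ⇑s₁ = ⇑s₂ from hst) x) y)

variable (ε w) in
/-- **The energy-cluster partition is energy-separated** (`h ≥ 0`): inequivalent particles are at
distance `> ε + h (√(2E_i) + √(2E_j))`, block energies of the partition itself. [folklore] -/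
theorem energyPartition_separated (hh : 0 ≤ h) :
    ∀ i j, ¬ energyPartition ε h w i j → ε + h * (Real.sqrt (blockEnergy₂ w (energyPartition ε h w) i) +
      Real.sqrt (blockEnergy₂ w (energyPartition ε h w) j)) < Torus.euclidDist (w i).1 (w j).1 := by
  have hclosed : InfClosed {s : Setoid (Fin N) | ∀ i j, ¬ s i j →
      ε + h * (Real.sqrt (blockEnergy₂ w s i) + Real.sqrt (blockEnergy₂ w s j)) <
        Torus.euclidDist (w i).1 (w j).1} := fun s hs s' hs' => inf_separated hh hs hs'
  have htop : (⊤ : Setoid (Fin N)) ∈ {s : Setoid (Fin N) | ∀ i j, ¬ s i j →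
      ε + h * (Real.sqrt (blockEnergy₂ w s i) + Real.sqrt (blockEnergy₂ w s j)) <
        Torus.euclidDist (w i).1 (w j).1} := fun i j hij => (hij (by rw [Setoid.top_def]; trivial)).elim
  haveI := finite_setoid_fin (N := N)
  exact hclosed.sInf_mem_of_nonempty (Set.toFinite _) ⟨⊤, htop⟩ subset_rfl

/-- **Minimality**: the energy-cluster partition is finer than every energy-separated relation.
[folklore] -/
theorem energyPartition_le {s : Setoid (Fin N)}
    (hs : ∀ i j, ¬ s i j → ε + h * (Real.sqrt (blockEnergy₂ w s i) + Real.sqrt (blockEnergy₂ w s j)) <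
      Torus.euclidDist (w i).1 (w j).1) :
    energyPartition ε h w ≤ s :=
  sInf_le hs

/-- The refinement of a relation `s` that cuts the set `U` out of every block. [folklore] -/
def cutSetoid (s : Setoid (Fin N)) (U : Set (Fin N)) : Setoid (Fin N) :=
  s ⊓ Setoid.ker (fun k => k ∈ U)

/-- The cut relation: `x ~ y` iff `x ~_s y` and (`x ∈ U ↔ y ∈ U`). [folklore] -/
theorem cutSetoid_iff {s : Setoid (Fin N)} {U : Set (Fin N)} {x y : Fin N} :
    cutSetoid s U x y ↔ s x y ∧ (x ∈ U ↔ y ∈ U) := by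
  rw [cutSetoid, Setoid.inf_iff_and, Setoid.ker_def, eq_iff_iff]

/-- The cut relation refines the original one. [folklore] -/
theorem cutSetoid_le (s : Setoid (Fin N)) (U : Set (Fin N)) : cutSetoid s U ≤ s := inf_le_left

/-- **Blocks of the energy-cluster partition cannot be split** (`h ≥ 0`): for every set `U` of labels
that cuts the block of some particle properly (`u₀ ~ v₀`, `u₀ ∈ U`, `v₀ ∉ U`), there are `u ∈ U` and
`v ∉ U` in one block at distance `≤ ε + h (√(2E'_u) + √(2E'_v))`, `E'` the kinetic energies of the
two parts of their block cut by `U` — otherwise the cut relation would be a strictly finer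
energy-separated relation.  (Hence a block `B` is connected at scale `ε + 2h √(2E_B)`.) [folklore] -/
theorem exists_close_pair_of_cut (hh : 0 ≤ h) (U : Set (Fin N)) {u₀ v₀ : Fin N}
    (huv : energyPartition ε h w u₀ v₀) (hu₀ : u₀ ∈ U) (hv₀ : v₀ ∉ U) :
    ∃ u v : Fin N, energyPartition ε h w u v ∧ u ∈ U ∧ v ∉ U ∧
      Torus.euclidDist (w u).1 (w v).1 ≤ ε + h *
        (Real.sqrt (blockEnergy₂ w (cutSetoid (energyPartition ε h w) U) u) +
          Real.sqrt (blockEnergy₂ w (cutSetoid (energyPartition ε h w) U) v)) := by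
  by_contra hno
  push Not at hno
  -- then the cut relation is energy-separated
  have hsep : ∀ i j, ¬ cutSetoid (energyPartition ε h w) U i j →
      ε + h * (Real.sqrt (blockEnergy₂ w (cutSetoid (energyPartition ε h w) U) i) +
        Real.sqrt (blockEnergy₂ w (cutSetoid (energyPartition ε h w) U) j)) <
        Torus.euclidDist (w i).1 (w j).1 := by
    intro i j hij
    by_cases hs : energyPartition ε h w i j
    · -- a new cut pair inside a block
      have hiff : ¬ (i ∈ U ↔ j ∈ U) := fun h' => hij (cutSetoid_iff.2 ⟨hs, h'⟩)
      rcases em (i ∈ U) with hi | hi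
      · exact hno i j hs hi fun hj => hiff ⟨fun _ => hj, fun _ => hi⟩
      · have hj : j ∈ U := by by_contra hj; exact hiff ⟨fun h => (hi h).elim, fun h => (hj h).elim⟩
        have h1 := hno j i ((energyPartition ε h w).symm' hs) hj hi
        rwa [Torus.euclidDist_comm, add_comm (Real.sqrt _)] at h1
    · -- inequivalent already for the partition: monotonicity of the energies
      exact separated_of_le hh (cutSetoid_le _ U) (energyPartition_separated ε w hh i j hs)
  -- hence coarser than the partition: `u₀ ~ v₀` for the cut relation, a contradiction
  exact hv₀ ((cutSetoid_iff.1 (energyPartition_le hsep huv)).2.1 hu₀)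

/-- **Blocks are connected at the block scale**: every proper cut `U` of the block `B` of `u₀ ~ v₀`
has a pair `u ∈ U ∩ B`, `v ∈ B ∖ U` at distance `≤ ε + 2h √(2E_B)`, `2E_B = blockEnergy₂` of the block
(cut by `U ∩ B`; the two parts have smaller energies).  With the spanning-tree count this is the input
of the static tail bound for the block sizes under the Gibbs law. [folklore] -/
theorem exists_close_pair_of_cut' (hh : 0 ≤ h) (U : Set (Fin N)) {u₀ v₀ : Fin N}
    (huv : energyPartition ε h w u₀ v₀) (hu₀ : u₀ ∈ U) (hv₀ : v₀ ∉ U) :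
    ∃ u v : Fin N, energyPartition ε h w u₀ u ∧ energyPartition ε h w u₀ v ∧ u ∈ U ∧ v ∉ U ∧
      Torus.euclidDist (w u).1 (w v).1 ≤
        ε + 2 * h * Real.sqrt (blockEnergy₂ w (energyPartition ε h w) u₀) := by
  -- cut by `U ∩ (block of u₀)`
  obtain ⟨u, v, huv', hu, hv, hd⟩ := exists_close_pair_of_cut hh (U ∩ {k | energyPartition ε h w u₀ k})
    huv ⟨hu₀, (energyPartition ε h w).refl' u₀⟩ (fun h' => hv₀ h'.1)
  have hu₀u : energyPartition ε h w u₀ u := hu.2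
  have hu₀v : energyPartition ε h w u₀ v := (energyPartition ε h w).trans' hu₀u huv'
  refine ⟨u, v, hu₀u, hu₀v, hu.1, fun hvU => hv ⟨hvU, hu₀v⟩, hd.trans ?_⟩
  have hle := cutSetoid_le (energyPartition ε h w) (U ∩ {k | energyPartition ε h w u₀ k})
  have hmu := Real.sqrt_le_sqrt (blockEnergy₂_mono w hle u)
  have hmv := Real.sqrt_le_sqrt (blockEnergy₂_mono w hle v)
  rw [← blockEnergy₂_eq_of_rel w _ hu₀u] at hmu
  rw [← blockEnergy₂_eq_of_rel w _ hu₀v] at hmv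
  nlinarith [mul_le_mul_of_nonneg_left (add_le_add hmu hmv) hh]

/-- The energy-separation event of a relation is a measurable set of configurations (finitely many
strict inequalities between measurable functions). [folklore] -/
theorem measurableSet_separated (ε h : ℝ) (s : Setoid (Fin N)) :
    MeasurableSet {w : Config N d (UnitAddTorus d) | ∀ i j, ¬ s i j →
      ε + h * (Real.sqrt (blockEnergy₂ w s i) + Real.sqrt (blockEnergy₂ w s j)) <
        Torus.euclidDist (w i).1 (w j).1} := by
  have hdist : ∀ i j : Fin N, Measurable fun w : Config N d (UnitAddTorus d) =>
      Torus.euclidDist (w i).1 (w j).1 := fun i j => by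
    simp only [← Torus.norm_geometry_sepVec]
    exact (Torus.measurable_geometry_sepVec.comp
      ((measurable_pi_apply i).fst.prodMk (measurable_pi_apply j).fst)).norm
  have : {w : Config N d (UnitAddTorus d) | ∀ i j, ¬ s i j →
      ε + h * (Real.sqrt (blockEnergy₂ w s i) + Real.sqrt (blockEnergy₂ w s j)) <
        Torus.euclidDist (w i).1 (w j).1} = ⋂ i, ⋂ j, {w | ¬ s i j →
      ε + h * (Real.sqrt (blockEnergy₂ w s i) + Real.sqrt (blockEnergy₂ w s j)) <
        Torus.euclidDist (w i).1 (w j).1} := by ext w; simp only [mem_setOf_eq, mem_iInter]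
  rw [this]
  refine MeasurableSet.iInter fun i => MeasurableSet.iInter fun j => ?_
  by_cases hij : s i j
  · have : {w : Config N d (UnitAddTorus d) | ¬ s i j →
        ε + h * (Real.sqrt (blockEnergy₂ w s i) + Real.sqrt (blockEnergy₂ w s j)) <
          Torus.euclidDist (w i).1 (w j).1} = univ := eq_univ_of_forall fun w hn => (hn hij).elim
    rw [this]; exact MeasurableSet.univ
  · have : {w : Config N d (UnitAddTorus d) | ¬ s i j →
        ε + h * (Real.sqrt (blockEnergy₂ w s i) + Real.sqrt (blockEnergy₂ w s j)) <
          Torus.euclidDist (w i).1 (w j).1} = {w | ε + h * (Real.sqrt (blockEnergy₂ w s i) +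
          Real.sqrt (blockEnergy₂ w s j)) < Torus.euclidDist (w i).1 (w j).1} :=
      Set.ext fun w => ⟨fun hw => hw hij, fun hw _ => hw⟩
    rw [this]
    exact measurableSet_lt (measurable_const.add (measurable_const.mul
      (((measurable_blockEnergy₂ s i).sqrt).add ((measurable_blockEnergy₂ s j).sqrt)))) (hdist i j)

/-- **The energy-cluster partition is a measurable functional of the configuration** (`h ≥ 0`): for
every relation `s`, the set of configurations whose partition is `s` is measurable — `s` is the
partition iff `s` is energy-separated and below every energy-separated relation (finitely many
relations). [folklore] -/
theorem measurableSet_energyPartition_eq (hh : 0 ≤ h) (ε : ℝ) (s : Setoid (Fin N)) :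
    MeasurableSet {w : Config N d (UnitAddTorus d) | energyPartition ε h w = s} := by
  have hchar : {w : Config N d (UnitAddTorus d) | energyPartition ε h w = s} =
      {w | ∀ i j, ¬ s i j → ε + h * (Real.sqrt (blockEnergy₂ w s i) + Real.sqrt (blockEnergy₂ w s j)) <
        Torus.euclidDist (w i).1 (w j).1} ∩ ⋂ s' ∈ {s' : Setoid (Fin N) | ¬ s ≤ s'},
        {w | ∀ i j, ¬ s' i j → ε + h * (Real.sqrt (blockEnergy₂ w s' i) +
          Real.sqrt (blockEnergy₂ w s' j)) < Torus.euclidDist (w i).1 (w j).1}ᶜ := by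
    ext w
    simp only [mem_setOf_eq, mem_inter_iff, mem_iInter, mem_compl_iff]
    constructor
    · rintro rfl
      exact ⟨energyPartition_separated ε w hh, fun s' hs' hsep' => hs' (energyPartition_le hsep')⟩
    · rintro ⟨hsep, hmin⟩
      refine le_antisymm (energyPartition_le hsep) ?_
      by_contra hle
      exact hmin _ hle (energyPartition_separated ε w hh)
  rw [hchar]
  haveI := finite_setoid_fin (N := N)
  refine (measurableSet_separated ε h s).inter ?_
  exact MeasurableSet.biInter (Set.toFinite _).countable fun s' _ => (measurableSet_separated ε h s').compl

/-! ## The stub: the separation in the form consumed by `stub_eqMomentClusterAutonomy` -/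

/-- **The energy-cluster partition at the window start is energy-separated for the window**
(registered sub-goal `stub_eqMomentEnergyPartition` of stub `stub_eqMoment`, line `Sketch`,
stmt-AtomisticToContinuum-12097): with `s = energyPartition ε (b - a) w` (`a ≤ b`) and the labelling
`cl = Quotient.mk s`, any two particles with different labels are at minimal-image distance
`> ε + (b - a) (√(Σ_{cl k = cl i} ‖v_k‖²) + √(Σ_{cl k = cl j} ‖v_k‖²))` — verbatim the hypothesis
`hsep` of `stub_eqMomentClusterAutonomy` for the configuration `w = Φ_a z`. [folklore] -/
theorem stub_eqMomentEnergyPartition {d : Type*} [Fintype d] {N : ℕ} (ε : ℝ) {a b : ℝ} (hab : a ≤ b)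
    (w : Config N d (UnitAddTorus d)) :
    ∀ i j, (Quotient.mk (energyPartition ε (b - a) w) i : Quotient (energyPartition ε (b - a) w)) ≠
        Quotient.mk (energyPartition ε (b - a) w) j →
      ε + (b - a) * (Real.sqrt (∑ k, if (Quotient.mk (energyPartition ε (b - a) w) k :
            Quotient (energyPartition ε (b - a) w)) = Quotient.mk (energyPartition ε (b - a) w) i
            then ‖(w k).2‖ ^ 2 else 0) +
        Real.sqrt (∑ k, if (Quotient.mk (energyPartition ε (b - a) w) k :
            Quotient (energyPartition ε (b - a) w)) = Quotient.mk (energyPartition ε (b - a) w) j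
            then ‖(w k).2‖ ^ 2 else 0)) <
      Torus.euclidDist (w i).1 (w j).1 := by
  intro i j hij
  rw [sum_ite_quotient_eq_blockEnergy₂, sum_ite_quotient_eq_blockEnergy₂]
  exact energyPartition_separated ε w (sub_nonneg.2 hab) i j fun h => hij (Quotient.sound h)

end Partition

end Summit.AtomisticToContinuum.HydrodynamicLimit.Theorems.ContactAngleEquidistributionSketch

end
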